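import Literature.AlgebraicGeometry.CubicSurfaces.OccultSystem
import Literature.AlgebraicGeometry.CubicSurfaces.SchlafliFrame
import Mathlib.LinearAlgebra.Charpoly.ToMatrix
import Mathlib.LinearAlgebra.Determinant
import Mathlib.Order.Filter.Cofinite
import HarnessLib

/-!
# The occult residual clause read on the `SO₅(𝔽₃)`-valued representation of the lines

Bridge (theorems only; no new definition, no new named fact) between the two carriers of the
cubic-surface content of the Langlands routes `CubicSurfaceE6Transport` / `OccultE6Transport`:

* the interface `CubicSurface.IsOccultSystem F 𝓢` (`OccultSystem.lean`), whose residual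
  clause (3) compares, modulo `λ₃ = (1 - ω)`, the Frobenius polynomials of the rank-`5`
  compatible system `𝓢` over `K = ℚ(ω)` with the characteristic polynomials of `Γ_K`-Frobenii
  on the quadratic `𝔽₃`-space `V(F)` of the `27` lines in its NATURAL (untwisted) action
  `CubicSurface.linesQuadRep` — the `Γ_K`-equivariant identification
  `Λ(T)/(1-ω)Λ(T) = V(T) ≅ V(S)` of [AllcockCarlsonToledo2002, (4.8)–(4.10)] and
  [Achter2014, Lemma 4.4, Prop 4.5] (differences of lines `↦ (1-ζ₃)`-torsion of the Prym);
* the framed, **det-twisted** representation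
  `CubicSurface.linesOrthogonalRep F : FramedGaloisRep k (ZMod 3) 5`, `σ ↦ det(w_σ)·w_σ`
  (`LinesOrthogonalRep.lean`), valued in `SO₅(𝔽₃) ≅ W(E₆)` [AllcockCarlsonToledo2002, (3.12)],
  which is the `ρ̄` the routes quantify over, restricted to `Γ_K` through
  `FramedGaloisRep.restrictField` in their reduction clause
  `(ρ.restrictField K σ).val.charpoly.map j = P₀ mod λ`.

The two differ on `Γ_K` exactly by the determinant character `σ ↦ det(linesQuadRep σ) = ±1`
of the natural action (reflections of `W(E₆) ↪ O(V(S))` have determinant `-1`, so on `W(E₆)`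
this is the sign character with kernel the index-two subgroup `D¹W(E₆)`); for the pentahedral
family over `ℚ` the Galois group on the `27` lines lies in `D¹W(E₆)` iff `(-3)Δ` is a perfect
square [ElsenhansJahnel2011, Thm 2.12], so there the character cuts out `ℚ(√(-3Δ))` and is
trivial on `Γ_K = Γ_{ℚ(√-3)}` iff `Δ ∈ ℚ^{×2} ∪ (-3)ℚ^{×2}` — in particular under the
square-discriminant hypothesis of the routes' intended witnesses.  Accordingly the bridge
`IsOccultSystem.residual_linesOrthogonalRep` carries the **parity hypothesis**
`hpar : ∀ σ : Γ_K, det (linesQuadRep (σ|_{ℚ̄})) = 1`; without it the polynomial on the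
twisted side at a Frobenius of determinant `-1` is `-P̄₀(-X)`, not `P̄₀(X)` (general formula
`coe_linesOrthogonalRep`: `ρ(σ) = det(M_σ) • M_σ`).

## Contents (all `[folklore]` linear algebra over the cited definitions)

* `LineFrame.coe_orthogonalRep`, `LineFrame.det_matrixRep`, `LineFrame.charpoly_matrixRep`:
  in a frame, `orthogonalRep σ = det(M_σ) • M_σ`, `det M_σ = det (linesQuadRep σ)`
  (basis-free), and the characteristic polynomial of `M_σ` is that of `linesQuadRep σ` in ANY
  basis (`LinearMap.charpoly_toMatrix`);
* `coe_linesOrthogonalRep`, `charpoly_linesOrthogonalRep_of_det_eq_one`: the same for the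
  chosen-frame representation `linesOrthogonalRep F` in the geometric case (finitely many lines
  and a frame, e.g. from a marking: `SchlafliMarking.linesOrthogonalRep_hyp`);
* `IsOccultSystem.residual_linesOrthogonalRep` (+ `_eventually`, the literal `∀ᶠ v in cofinite`
  shape of the routes, and `_of_marking`, hypotheses read on a marking of the `27` lines, where
  the parity hypothesis becomes `det (frameMatrix (perm σ)) = 1`).

## References

* [AllcockCarlsonToledo2002] D. Allcock, J. Carlson, D. Toledo, *The complex hyperbolic geometry
  of the moduli space of cubic surfaces*, J. Algebraic Geom. 11 (2002): (2.12), (3.12),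
  (4.8)–(4.10).
* [Achter2014] J. Achter, *Arithmetic Torelli maps for cubic surfaces and threefolds*, Trans.
  AMS 366 (2014): Lemma 4.4, Prop 4.5.
* [ElsenhansJahnel2011] A.-S. Elsenhans, J. Jahnel, *The discriminant of a cubic surface*, Geom.
  Dedicata 159 (2012) (arXiv:1006.0721): Thm 2.12 (pentahedral family: Galois group in
  `D¹W(E₆)` iff `(-3)Δ` is a perfect square).
-/

noncomputable section

open Polynomial NumberField IsDedekindDomain Field Filter
open Literature.NumberTheory.GaloisRepresentations

namespace Literature.AlgebraicGeometry.CubicSurfaces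

namespace CubicSurface

/-! ### In a frame: `orthogonalRep = det • matrixRep`, basis-free determinant and charpoly -/

section Frame

variable {k : Type*} [Field k] {K : Type*} [Field K] [Algebra k K] {F : MvPolynomial (Fin 4) k}
variable {G : Type*} [Group G] [MulSemiringAction G K] [SMulCommClass G k K]

/-- In a frame `b` of `V(F)`, the `SO₅(𝔽₃)`-valued representation is `σ ↦ det([σ]_b)·[σ]_b` as a
matrix.  Ref: Allcock–Carlson–Toledo (2002), (3.12). [folklore] -/
theorem LineFrame.coe_orthogonalRep (fr : LineFrame K F) (σ : G) :
    ((fr.orthogonalRep σ : GL (Fin 5) (ZMod 3)) : Matrix (Fin 5) (Fin 5) (ZMod 3)) =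
      (fr.matrixRep σ).det • fr.matrixRep σ :=
  rfl

/-- The determinant of the matrix of `σ` in a frame is the (basis-free) determinant of `σ` acting
on `V(F)`. [folklore] -/
theorem LineFrame.det_matrixRep (fr : LineFrame K F) (σ : G) :
    (fr.matrixRep σ).det = LinearMap.det (linesQuadRep K F σ) :=
  LinearMap.det_toMatrix fr.basis (linesQuadRep K F σ)

/-- If `σ` acts on `V(F)` with determinant `1`, its value under the `SO₅(𝔽₃)`-valued
representation of a frame is its plain matrix in that frame (no twist). [folklore] -/
theorem LineFrame.coe_orthogonalRep_of_det_eq_one (fr : LineFrame K F) {σ : G}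
    (hσ : LinearMap.det (linesQuadRep K F σ) = 1) :
    ((fr.orthogonalRep σ : GL (Fin 5) (ZMod 3)) : Matrix (Fin 5) (Fin 5) (ZMod 3)) =
      fr.matrixRep σ := by
  rw [fr.coe_orthogonalRep, fr.det_matrixRep, hσ, one_smul]

/-- The characteristic polynomial of the matrix of `σ` in a frame equals the characteristic
polynomial of the matrix of `σ` on `V(F)` in ANY basis `b` (characteristic polynomials do not
depend on the basis). [folklore] -/
theorem LineFrame.charpoly_matrixRep (fr : LineFrame K F) {ι : Type*} [Fintype ι]
    [DecidableEq ι] (b : Module.Basis ι (ZMod 3) (LinesQuadSpace K F)) (σ : G) :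
    (fr.matrixRep σ).charpoly = (LinearMap.toMatrix b b (linesQuadRep K F σ)).charpoly := by
  haveI : Module.Finite (ZMod 3) (LinesQuadSpace K F) := Module.Finite.of_basis b
  change (LinearMap.toMatrix fr.basis fr.basis (linesQuadRep K F σ)).charpoly = _
  rw [LinearMap.charpoly_toMatrix, LinearMap.charpoly_toMatrix]

/-- Under `det = 1` the characteristic polynomial of `orthogonalRep σ` is that of `σ` on `V(F)` in
any basis. [folklore] -/
theorem LineFrame.charpoly_orthogonalRep_of_det_eq_one (fr : LineFrame K F) {ι : Type*}
    [Fintype ι] [DecidableEq ι] (b : Module.Basis ι (ZMod 3) (LinesQuadSpace K F)) {σ : G}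
    (hσ : LinearMap.det (linesQuadRep K F σ) = 1) :
    ((fr.orthogonalRep σ : GL (Fin 5) (ZMod 3)) : Matrix (Fin 5) (Fin 5) (ZMod 3)).charpoly =
      (LinearMap.toMatrix b b (linesQuadRep K F σ)).charpoly := by
  rw [fr.coe_orthogonalRep_of_det_eq_one hσ, fr.charpoly_matrixRep b]

end Frame

/-! ### The chosen-frame Galois representation `linesOrthogonalRep` -/

section Galois

variable {k : Type*} [Field k] {F : MvPolynomial (Fin 4) k}

/-- In the geometric case (finitely many lines, a frame exists) the value of
`linesOrthogonalRep F` at `σ ∈ Gal(k̄/k)` is `det(M_σ) • M_σ`, `M_σ` the matrix of `σ` on `V(F)`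
in the chosen frame.  Ref: Allcock–Carlson–Toledo (2002), (3.12), (4.8). [folklore] -/
theorem coe_linesOrthogonalRep
    (hF : (lines (AlgebraicClosure k) F).Finite ∧ Nonempty (LineFrame (AlgebraicClosure k) F))
    (σ : absoluteGaloisGroup k) :
    ((linesOrthogonalRep F σ : GL (Fin 5) (ZMod 3)) : Matrix (Fin 5) (Fin 5) (ZMod 3)) =
      ((Classical.choice hF.2).matrixRep σ).det • (Classical.choice hF.2).matrixRep σ := by
  rw [linesOrthogonalRep_eq F hF]
  rfl

/-- **No twist on determinant-one elements.**  In the geometric case, if `σ ∈ Gal(k̄/k)` acts on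
`V(F)` with determinant `1`, then the characteristic polynomial of `linesOrthogonalRep F σ` is the
characteristic polynomial of `σ` on `V(F)` (natural action `linesQuadRep`) in any basis `b`.
[folklore] -/
theorem charpoly_linesOrthogonalRep_of_det_eq_one
    (hF : (lines (AlgebraicClosure k) F).Finite ∧ Nonempty (LineFrame (AlgebraicClosure k) F))
    {ι : Type*} [Fintype ι] [DecidableEq ι]
    (b : Module.Basis ι (ZMod 3) (LinesQuadSpace (AlgebraicClosure k) F))
    {σ : absoluteGaloisGroup k} (hσ : LinearMap.det (linesQuadRep (AlgebraicClosure k) F σ) = 1) :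
    ((linesOrthogonalRep F σ : GL (Fin 5) (ZMod 3)) : Matrix (Fin 5) (Fin 5) (ZMod 3)).charpoly =
      (LinearMap.toMatrix b b (linesQuadRep (AlgebraicClosure k) F σ)).charpoly := by
  rw [linesOrthogonalRep_eq F hF]
  exact (Classical.choice hF.2).charpoly_orthogonalRep_of_det_eq_one b hσ

end Galois

/-! ### The residual clause of an occult system on `linesOrthogonalRep|Γ_K` -/

section Occult

variable {F : MvPolynomial (Fin 4) ℚ}
  {𝓢 : CompatibleSystem (CyclotomicField 3 ℚ) (CyclotomicField 3 ℚ) 5}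

/-- **The occult residual clause on the `SO₅(𝔽₃)`-valued representation of the lines.**
Let `𝓢` be an occult system of the cubic form `F` over `ℚ` (`IsOccultSystem F 𝓢`), assume the
lines of `F` over `ℚ̄` are finitely many with a frame of `V(F)` (e.g. `F` marked:
`SchlafliMarking.linesOrthogonalRep_hyp`), and assume the **parity hypothesis**: every
`σ ∈ Γ_K`, `K = ℚ(ω)`, acts on `V(F)` with determinant `1` (the determinant character of the
`27`-line representation is trivial on `Γ_{ℚ(√-3)}`, i.e. `Γ_K` acts through `D¹W(E₆)`; for the
pentahedral family this says `(-3)Δ` is a square in `ℚ(√-3)` [ElsenhansJahnel2011, Thm 2.12]).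
Then there are a prime `λ ∋ 3` of `𝓞_K`
and `j : 𝔽₃ →+* 𝓞_K/λ` such that at every good place `v` some `𝓞_K`-integral lift `P₀` of
`𝓢.charpoly v` reduces modulo `λ` to the characteristic polynomial of
`(linesOrthogonalRep F)|_{Γ_K}(σ)` for every arithmetic Frobenius `σ` at every prime above `v` —
the reduction clause of the routes with `ρ̄ := linesOrthogonalRep F`.
Ref: Allcock–Carlson–Toledo (2002), (4.8)–(4.10); Achter (2014), Prop 4.5.
[cite: AllcockCarlsonToledo2002, (4.8)–(4.10)] -/
theorem IsOccultSystem.residual_linesOrthogonalRep (h : IsOccultSystem F 𝓢)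
    (hF : (lines (AlgebraicClosure ℚ) F).Finite ∧ Nonempty (LineFrame (AlgebraicClosure ℚ) F))
    (hpar : ∀ σ : absoluteGaloisGroup (CyclotomicField 3 ℚ),
      LinearMap.det (linesQuadRep (AlgebraicClosure ℚ) F
        (absGaloisRestrict ℚ (CyclotomicField 3 ℚ) σ)) = 1) :
    ∃ («λ» : HeightOneSpectrum (𝓞 (CyclotomicField 3 ℚ)))
      (j : ZMod 3 →+* 𝓞 (CyclotomicField 3 ℚ) ⧸ «λ».asIdeal),
    (3 : 𝓞 (CyclotomicField 3 ℚ)) ∈ «λ».asIdeal ∧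
    ∀ v : HeightOneSpectrum (𝓞 (CyclotomicField 3 ℚ)), v ∉ 𝓢.bad →
      ∃ P₀ : Polynomial (𝓞 (CyclotomicField 3 ℚ)),
        P₀.map (algebraMap (𝓞 (CyclotomicField 3 ℚ)) (CyclotomicField 3 ℚ)) = 𝓢.charpoly v ∧
        ∀ 𝔓 ∈ v.primesAbove, ∀ σ : absoluteGaloisGroup (CyclotomicField 3 ℚ),
          IsArithFrobAt (𝓞 (CyclotomicField 3 ℚ)) σ 𝔓 →
          ((linesOrthogonalRep F).restrictField (CyclotomicField 3 ℚ) σ).val.charpoly.map j =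
            P₀.map (Ideal.Quotient.mk «λ».asIdeal) := by
  obtain ⟨«λ», j, b, h3, H⟩ := h.residual
  refine ⟨«λ», j, h3, fun v hv => ?_⟩
  obtain ⟨P₀, hP₀, hFrob⟩ := H v hv
  refine ⟨P₀, hP₀, fun 𝔓 h𝔓 σ hσ => ?_⟩
  rw [FramedGaloisRep.restrictField_apply, charpoly_linesOrthogonalRep_of_det_eq_one hF b (hpar σ)]
  exact hFrob 𝔓 h𝔓 σ hσ

/-- The same bridge in the literal `∀ᶠ v in cofinite` shape of the routes' reduction clause
(`𝓢.bad` is finite). [cite: AllcockCarlsonToledo2002, (4.8)–(4.10)] -/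
theorem IsOccultSystem.residual_linesOrthogonalRep_eventually (h : IsOccultSystem F 𝓢)
    (hF : (lines (AlgebraicClosure ℚ) F).Finite ∧ Nonempty (LineFrame (AlgebraicClosure ℚ) F))
    (hpar : ∀ σ : absoluteGaloisGroup (CyclotomicField 3 ℚ),
      LinearMap.det (linesQuadRep (AlgebraicClosure ℚ) F
        (absGaloisRestrict ℚ (CyclotomicField 3 ℚ) σ)) = 1) :
    ∃ («λ» : HeightOneSpectrum (𝓞 (CyclotomicField 3 ℚ)))
      (j : ZMod 3 →+* 𝓞 (CyclotomicField 3 ℚ) ⧸ «λ».asIdeal),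
    (3 : 𝓞 (CyclotomicField 3 ℚ)) ∈ «λ».asIdeal ∧
    ∀ᶠ v : HeightOneSpectrum (𝓞 (CyclotomicField 3 ℚ)) in cofinite,
      ∃ P₀ : Polynomial (𝓞 (CyclotomicField 3 ℚ)),
        P₀.map (algebraMap (𝓞 (CyclotomicField 3 ℚ)) (CyclotomicField 3 ℚ)) = 𝓢.charpoly v ∧
        ∀ 𝔓 ∈ v.primesAbove, ∀ σ : absoluteGaloisGroup (CyclotomicField 3 ℚ),
          IsArithFrobAt (𝓞 (CyclotomicField 3 ℚ)) σ 𝔓 →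
          ((linesOrthogonalRep F).restrictField (CyclotomicField 3 ℚ) σ).val.charpoly.map j =
            P₀.map (Ideal.Quotient.mk «λ».asIdeal) := by
  obtain ⟨«λ», j, h3, H⟩ := h.residual_linesOrthogonalRep hF hpar
  exact ⟨«λ», j, h3, (𝓢.bad.eventually_cofinite_notMem).mono H⟩

/-- **Marked form.**  With a marking `m` of the lines of `F` over `ℚ̄` (which supplies the
finiteness of the lines and the frame) the parity hypothesis reads on the explicit matrices
`frameMatrix (m.perm σ)` of `SchlafliFrame.lean`: if `det (frameMatrix (m.perm (σ|_{ℚ̄}))) = 1`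
for every `σ ∈ Γ_K`, the residual clause of an occult system holds on
`(linesOrthogonalRep F)|_{Γ_K}`.  Ref: Achter (2014), Lemma 4.4, Prop 4.5.
[cite: Achter2014, Lemma 4.4, Prop 4.5] -/
theorem IsOccultSystem.residual_linesOrthogonalRep_of_marking (h : IsOccultSystem F 𝓢)
    (m : SchlafliMarking (AlgebraicClosure ℚ) F)
    (hpar : ∀ σ : absoluteGaloisGroup (CyclotomicField 3 ℚ),
      (SchlafliMarking.frameMatrix
        (m.perm (absGaloisRestrict ℚ (CyclotomicField 3 ℚ) σ))).det = 1) :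
    ∃ («λ» : HeightOneSpectrum (𝓞 (CyclotomicField 3 ℚ)))
      (j : ZMod 3 →+* 𝓞 (CyclotomicField 3 ℚ) ⧸ «λ».asIdeal),
    (3 : 𝓞 (CyclotomicField 3 ℚ)) ∈ «λ».asIdeal ∧
    ∀ v : HeightOneSpectrum (𝓞 (CyclotomicField 3 ℚ)), v ∉ 𝓢.bad →
      ∃ P₀ : Polynomial (𝓞 (CyclotomicField 3 ℚ)),
        P₀.map (algebraMap (𝓞 (CyclotomicField 3 ℚ)) (CyclotomicField 3 ℚ)) = 𝓢.charpoly v ∧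
        ∀ 𝔓 ∈ v.primesAbove, ∀ σ : absoluteGaloisGroup (CyclotomicField 3 ℚ),
          IsArithFrobAt (𝓞 (CyclotomicField 3 ℚ)) σ 𝔓 →
          ((linesOrthogonalRep F).restrictField (CyclotomicField 3 ℚ) σ).val.charpoly.map j =
            P₀.map (Ideal.Quotient.mk «λ».asIdeal) := by
  refine h.residual_linesOrthogonalRep m.linesOrthogonalRep_hyp fun σ => ?_
  rw [← LinearMap.det_toMatrix m.basis, m.toMatrix_linesQuadRep]
  exact hpar σ

end Occult

end CubicSurface

end Literature.AlgebraicGeometry.CubicSurfaces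

end
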